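import Summits.Ventures.PercRepro.GenQHyperplaneFlow

/-!
# PercRepro — the rank-`(q−1)` subsets of `G` are counted by the hyperplanes (night-4, gen 7)

A `j`-subset `T ⊆ G` of rank `q − 1` spans exactly one rank-`(q − 1)` flat, its closure; so
`#{T ⊆ G : |T| = j, rk T = q − 1} = Σ_{H ∈ flatsQ (q−1)} spF M G H (q−1) j` (`card_rank_subsets_eq_sum_spF`) —
the row (H2) of the hyperplane-trace block (sheet §62 (k4)) as an exact identity; with the spanning `j`-subsets it
bounds the non-spanning ones from below.  Imports `GenQHyperplaneFlow` (for `spF`).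
-/
namespace PercRepro.Night4

open Finset ThmH SixFour GenQ PerFlat Star

variable {α : Type*} [DecidableEq α] {M : Matroid α} [M.Finite]

/-- **(H2)** The rank-`r` `j`-subsets of `G ⊆ gr M` are partitioned by their closures, which are the rank-`r` flats:
`#{T ⊆ G : |T| = j, rk T = r} = Σ_{H ∈ flatsQ M r} spF M G H r j`. -/
theorem card_rank_subsets_eq_sum_spF {G : Finset α} (hG : G ⊆ gr M) (r j : ℕ) :
    ((G.powersetCard j).filter (fun T : Finset α => M.eRk (T : Set α) = (r : ℕ∞))).card
      = ∑ H ∈ flatsQ M r, spF M G H r j := by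
  classical
  -- fiberwise over the closure `clF M T`, which lands in `flatsQ M r`
  rw [Finset.card_eq_sum_card_fiberwise (f := fun T => clF M T) (t := flatsQ M r)]
  · refine Finset.sum_congr rfl (fun H hH => ?_)
    unfold spF
    congr 1
    ext T
    simp only [Finset.mem_filter, Finset.mem_powersetCard]
    have hH' := mem_flatsQ.1 hH
    constructor
    · rintro ⟨⟨⟨hTG, hTj⟩, hrT⟩, hcl⟩
      refine ⟨⟨?_, hTj⟩, hrT⟩
      intro x hx
      rw [Finset.mem_inter]
      refine ⟨?_, hTG hx⟩
      rw [← hcl, mem_clF]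
      refine M.subset_closure _ ?_ (Finset.mem_coe.2 hx)
      rw [← coe_gr M]
      exact Finset.coe_subset.2 (hTG.trans hG)
    · rintro ⟨⟨hTHG, hTj⟩, hrT⟩
      have hTH : T ⊆ H := hTHG.trans Finset.inter_subset_left
      have hTG : T ⊆ G := hTHG.trans Finset.inter_subset_right
      refine ⟨⟨⟨hTG, hTj⟩, hrT⟩, ?_⟩
      apply Finset.coe_injective
      rw [coe_clF]
      have h1 : M.closure (T : Set α) = M.closure (H : Set α) :=
        (M.isRkFinite_of_finite (Finset.finite_toSet T)).closure_eq_closure_of_subset_of_eRk_ge_eRk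
          (Finset.coe_subset.2 hTH) (by rw [hrT, hH'.2.2])
      rw [h1, hH'.2.1.closure]
  · intro T hT
    rw [Finset.mem_coe, Finset.mem_filter] at hT
    show clF M T ∈ flatsQ M r
    rw [mem_flatsQ, ← Finset.coe_subset, coe_clF, coe_gr]
    exact ⟨M.closure_subset_ground _, M.isFlat_closure _, by rw [M.eRk_closure_eq, hT.2]⟩

end PercRepro.Night4
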